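import Summits.QuantumFields.GaugeBoot.BootstrapBoundsConvergenceZd
import Summits.QuantumFields.GaugeBoot.LatticeBoxAverages
import Summits.QuantumFields.GaugeBoot.FunctionalSequenceLimits
import HarnessLib

/-!
# The translation-reduced SDP bound of a Wilson loop on `ℤ^d` is the infimum over boxes of the plain bound on its box average (gauge-boot, L1/L4 supplement)

HONEST FRAMING (cell `pub-gaugeboot`, page 1 of every file): the venture produces certified bounds
on lattice expectations at stated coupling, gauge group, dimension and torus size; NOT a mass gap,
NOT a continuum limit, NOT a string tension; NOT Yang–Mills-summit-bearing (barriers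
`FixedCouplingUltralocality`, `PerturbativeInvisibility`). Structural; it certifies no number.

## Content (`SU(N)` on `ℤ^{d+1}`, any real `β`, word level `n`, `P` a combination of words of length `≤ 2n`)

On the torus, imposing translation invariance on the level-`n` SDP computes the plain level-`n`
bound of the LATTICE AVERAGE of the objective (`symLevelValues_eq_levelValues_avgObs_suN`). On the
infinite lattice there is no lattice average; the exact substitute is the family of BOX AVERAGES
`boxAvgObs k P = k^{-(d+1)} Σ_{b ∈ [0,k)^{d+1}} P ∘ τ_b`:

* (`FunctionalSequenceLimits`: `seqLim χ`, the Banach limit of a sequence of functionals;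
  `forall_invariant_of_single`); `exists_forall_feasible_abs_le` (uniform bound of all level-`n`
  solutions on the certificate domain);
* `boxAvgObs`, `boxAvgObs_mem_wordTruncation`, `avgFunctional_box_apply`;
  ★ `abs_avgFunctional_box_shift_sub_le` — the box average of a level-`n` solution is
  `2C/k`-ALMOST translation invariant on each element of the certificate domain (Følner property of
  boxes, `LatticeBoxAverages`);
* ★★ `isBootstrapFeasible_seqLim`, `seqLim_translationInvariant` — a Banach limit (in the box size)
  of box-averaged level-`n` solutions is a level-`n` solution which is EXACTLY translation invariant
  on the words of length `≤ 2n` (invariance under the unit vectors passes to all of `ℤ^{d+1}`);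
* ★★★ `sSup_symLevelValuesZd_eq_iInf_boxAvg_suN` — THE REDUCED UPPER BOUND OF `P` EQUALS THE INFIMUM
  OVER `k` OF THE PLAIN UPPER BOUNDS OF ITS BOX AVERAGES `boxAvgObs (k+1) P` (`≤` each:
  `sSup_symLevelValuesZd_le_boxAvg_suN`; `≥`: Banach limit of box averages of box-optimisers).

What this is NOT: whether the infimum is attained at a finite box / whether the reduced bound is
strictly below the plain bound of `P` itself; the dual statement for lower bounds is the same
argument with `-P` (not spelled out); rates in `k`; `d = 0`.

References: E. Følner, Math. Scand. 3 (1955) 243; V. Kazakov, Z. Zheng, arXiv:2203.11360 §3;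
K. Gatermann, P. A. Parrilo (2004) Thm 3.3. Folklore.
-/

noncomputable section

open MeasureTheory Filter Topology NormedSpace Finset
open Literature.MathematicalPhysics.QuantumFieldTheory (LatticeRep)
open Literature.MathematicalPhysics.QuantumLattice

namespace Summit.QuantumFields.GaugeBoot

open CesaroLimit LatticeBox

/-! ## Uniform bounds and box averages -/

section Boxes

variable {d : ℕ} {G : Type*} [Group G] [TopologicalSpace G] (r : LatticeRep G)
  {K : Type*} {k : K → ℝ → G} {S : ZdEdge (d + 1) → LGConfig (d + 1) G → ℝ} {β : ℝ}

/-- **All level-`n` solutions are uniformly bounded on each element of the certificate domain**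
(`1` is an order unit). -/
theorem exists_forall_feasible_abs_le {n : ℕ} {x : C(LGConfig (d + 1) G, ℝ)} (hx : x ∈ certDomain r k S β n) :
    ∃ C : ℝ, ∀ φ : C(LGConfig (d + 1) G, ℝ) →ₗ[ℝ] ℝ,
      IsBootstrapFeasible r k S β (wordTruncation (ι := ZdEdge (d + 1)) r n) φ → |φ x| ≤ C := by
  obtain ⟨⟨t, ht⟩, ⟨t', ht'⟩⟩ := exists_smul_one_sub_mem_certCone r hx
  have ht'' : x - (-t') • (1 : C(LGConfig (d + 1) G, ℝ)) ∈ certCone r k S β (wordTruncation (ι := ZdEdge (d + 1)) r n) := by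
    rwa [neg_smul, sub_neg_eq_add, add_comm x]
  refine ⟨max |t| |t'|, fun φ hφ => abs_le.2 ⟨?_, ?_⟩⟩
  · have h := hφ.le_apply_of_mem_certCone r ht''
    have h1 : t' ≤ |t'| := le_abs_self t'
    have h2 : |t'| ≤ max |t| |t'| := le_max_right _ _
    linarith
  · exact (hφ.apply_le_of_mem_certCone r ht).trans ((le_abs_self t).trans (le_max_left _ _))

omit [Group G] in
/-- **The box average of an observable** over `[0,k)^{d+1}`. [folklore] -/
def boxAvgObs (k : ℕ) (P : C(LGConfig (d + 1) G, ℝ)) : C(LGConfig (d + 1) G, ℝ) :=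
  ((k : ℝ) ^ (d + 1))⁻¹ • ∑ b : Fin (d + 1) → Fin k, P.comp (relabelCM (G := G) (edgeShift (boxPt k b)))

/-- The box average of a combination of words of length `≤ m` is one. -/
theorem boxAvgObs_mem_wordTruncation {m : ℕ} (k : ℕ) {P : C(LGConfig (d + 1) G, ℝ)}
    (hP : P ∈ wordTruncation (ι := ZdEdge (d + 1)) r m) :
    boxAvgObs k P ∈ wordTruncation (ι := ZdEdge (d + 1)) r m := by
  unfold boxAvgObs wordTruncation
  refine Submodule.smul_mem _ _ (Submodule.sum_mem _ fun b _ => ?_)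
  exact comp_relabelCM_edgeShift_mem_wordTruncation r m _ hP

omit [Group G] in
/-- **The box translations** as a finite family of configuration maps. -/
def boxMaps (k : ℕ) (b : Fin (d + 1) → Fin k) : C(LGConfig (d + 1) G, LGConfig (d + 1) G) :=
  relabelCM (G := G) (edgeShift (boxPt k b))

omit [Group G] in
/-- **The box-averaged functional evaluated**: `avg_k φ P = φ (boxAvgObs k P)` (both sides are `0` for `k = 0`). -/
theorem avgFunctional_box_apply (k : ℕ) (φ : C(LGConfig (d + 1) G, ℝ) →ₗ[ℝ] ℝ)
    (P : C(LGConfig (d + 1) G, ℝ)) :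
    avgFunctional (boxMaps (G := G) k) φ P = φ (boxAvgObs k P) := by
  rw [avgFunctional_apply, boxAvgObs, map_smul, map_sum, smul_eq_mul, Fintype.card_fun, Fintype.card_fin,
    Fintype.card_fin]
  push_cast
  rfl

omit [Group G] in
/-- ★ **Box averages of a functional are almost translation invariant**: if `|φ (x ∘ τ_v)| ≤ C` for
all `v`, then `|avg_k φ (x ∘ τ_{e_j}) - avg_k φ x| ≤ 2C/k`. -/
theorem abs_avgFunctional_box_shift_sub_le {k : ℕ} (hk : 0 < k) (φ : C(LGConfig (d + 1) G, ℝ) →ₗ[ℝ] ℝ)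
    {x : C(LGConfig (d + 1) G, ℝ)} {C : ℝ}
    (hC : ∀ v : Fin (d + 1) → ℤ, |φ (x.comp (relabelCM (G := G) (edgeShift v)))| ≤ C) (j : Fin (d + 1)) :
    |avgFunctional (boxMaps (G := G) k) φ (x.comp (relabelCM (G := G) (edgeShift (Pi.single j 1)))) -
        avgFunctional (boxMaps (G := G) k) φ x| ≤ 2 * C / k := by
  haveI : NeZero k := ⟨hk.ne'⟩
  have h1 : avgFunctional (boxMaps (G := G) k) φ (x.comp (relabelCM (G := G) (edgeShift (Pi.single j 1)))) =
      ((k : ℝ) ^ (d + 1))⁻¹ * boxSum k (fun v => orbitFn φ x (v + Pi.single j 1)) := by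
    rw [avgFunctional_apply, Fintype.card_fun, Fintype.card_fin, Fintype.card_fin, boxSum]
    push_cast
    congr 1
    refine Finset.sum_congr rfl fun b _ => ?_
    simp only [boxMaps, orbitFn_apply, comp_relabelCM_edgeShift_comp, add_comm]
  have h2 : avgFunctional (boxMaps (G := G) k) φ x = ((k : ℝ) ^ (d + 1))⁻¹ * boxSum k (orbitFn φ x) := by
    rw [avgFunctional_apply, Fintype.card_fun, Fintype.card_fin, Fintype.card_fin, boxSum]
    push_cast
    rfl
  rw [h1, h2]
  exact abs_boxAvg_shift_single_sub_le hk (fun v => by rw [orbitFn_apply]; exact hC v) j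

end Boxes

/-! ## `SU(N)` on `ℤ^{d+1}`: the box characterisation of the reduced bound -/

section ZdSuN

variable {d : ℕ} (N : ℕ) (β : ℝ)

/-- ★ **Every reduced value of `P` is a plain value of each of its box averages** (`P` of length
`≤ 2n`, box side `k ≥ 1`). -/
theorem symLevelValuesZd_subset_levelValuesZd_boxAvg_suN {n k : ℕ} (hk : 0 < k)
    {P : C(LGConfig (d + 1) (Matrix.specialUnitaryGroup (Fin N) ℂ), ℝ)}
    (hP : P ∈ wordTruncation (ι := ZdEdge (d + 1)) (fundamentalLatticeRep N) (n + n)) :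
    symLevelValuesZdSuN (d := d + 1) N β n P ⊆
      levelValuesZdSuN (d := d + 1) N β n (boxAvgObs k P) := by
  rintro t ⟨φ, hφ, hinv, rfl⟩
  refine ⟨φ, hφ, ?_⟩
  rw [← avgFunctional_box_apply k, avgFunctional_apply]
  haveI : NeZero k := ⟨hk.ne'⟩
  have h : ∀ b : Fin (d + 1) → Fin k,
      φ (P.comp (boxMaps (G := Matrix.specialUnitaryGroup (Fin N) ℂ) k b)) = φ P := fun b => hinv _ P hP
  simp only [h, Finset.sum_const, Finset.card_univ, nsmul_eq_mul]
  have hc : (Fintype.card (Fin (d + 1) → Fin k) : ℝ) ≠ 0 := Nat.cast_ne_zero.2 Fintype.card_ne_zero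
  field_simp

/-- ★ **The reduced upper bound is below the plain upper bound of every box average.** -/
theorem sSup_symLevelValuesZd_le_boxAvg_suN {n k : ℕ} (hk : 0 < k)
    {P : C(LGConfig (d + 1) (Matrix.specialUnitaryGroup (Fin N) ℂ), ℝ)}
    (hP : P ∈ wordTruncation (ι := ZdEdge (d + 1)) (fundamentalLatticeRep N) (n + n)) :
    sSup (symLevelValuesZdSuN (d := d + 1) N β n P) ≤
      sSup (levelValuesZdSuN (d := d + 1) N β n (boxAvgObs k P)) := by
  obtain ⟨hbdd, -, -⟩ := bdd_levelValuesZd_suN N β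
    (mem_certDomain_of_mem_wordTruncation _ (boxAvgObs_mem_wordTruncation (fundamentalLatticeRep N) k hP))
  exact csSup_le_csSup hbdd (symLevelValuesZd_nonempty N β n P)
    (symLevelValuesZd_subset_levelValuesZd_boxAvg_suN N β hk hP)

/-- ★★ **A Banach limit of level-`n` solutions is a level-`n` solution.** -/
theorem isBootstrapFeasible_seqLim {n : ℕ}
    (χ : ℕ → C(LGConfig (d + 1) (Matrix.specialUnitaryGroup (Fin N) ℂ), ℝ) →ₗ[ℝ] ℝ)
    (hχ : ∀ k, IsBootstrapFeasible (fundamentalLatticeRep N) (suExp N)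
      (fun e => wilsonBoundaryAction (fundamentalRep (Fin N)) {e}) β
      (wordTruncation (ι := ZdEdge (d + 1)) (fundamentalLatticeRep N) n) (χ k)) :
    IsBootstrapFeasible (fundamentalLatticeRep N) (suExp N)
      (fun e => wilsonBoundaryAction (fundamentalRep (Fin N)) {e}) β
      (wordTruncation (ι := ZdEdge (d + 1)) (fundamentalLatticeRep N) n) (seqLim χ) := by
  have hbd : ∀ x ∈ certDomainZdSuN (d := d + 1) N β n, x ∈ seqBounded χ := fun x hx => by
    obtain ⟨C, hC⟩ := exists_forall_feasible_abs_le (fundamentalLatticeRep N) hx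
    exact ⟨C, fun k => hC _ (hχ k)⟩
  refine ⟨seqLim_eq_of_forall_eq χ fun k => (hχ k).1, fun v hv => ?_, fun i a => ?_⟩
  · exact seqLim_nonneg χ (hbd _ (mem_certDomain_of_mem_wordTruncation _ (mul_mem_wordTruncation_add _ hv hv)))
      fun k => (hχ k).2.1 v hv
  · obtain ⟨S', hS'm, hS'd, -⟩ := (hχ 0).2.2 i a
    refine ⟨S', hS'm, hS'd, fun f hf f' hf'm hf'd => ?_⟩
    have hmem : f' - β • (f * S') ∈ rowSet (fundamentalLatticeRep N) (suExp N)
        (fun e => wilsonBoundaryAction (fundamentalRep (Fin N)) {e}) β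
        (wordTruncation (ι := ZdEdge (d + 1)) (fundamentalLatticeRep N) n) :=
      ⟨i, a, f, f', S', hf, hf'm, hS'm, hS'd, hf'd, rfl⟩
    have h := seqLim_eq_of_forall_eq χ (x := f' - β • (f * S')) (c := 0)
      fun k => (hχ k).apply_eq_zero_of_mem_rowSet (fundamentalLatticeRep N) hmem
    rwa [map_sub, map_smul, smul_eq_mul, sub_eq_zero] at h

/-- ★★ **A Banach limit of box-averaged level-`n` solutions is translation invariant on the words of
length `≤ 2n`** (box `[0,k+1)^{d+1}` at stage `k`). -/
theorem seqLim_translationInvariant {n : ℕ}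
    (φ : ℕ → C(LGConfig (d + 1) (Matrix.specialUnitaryGroup (Fin N) ℂ), ℝ) →ₗ[ℝ] ℝ)
    (hφ : ∀ k, IsBootstrapFeasible (fundamentalLatticeRep N) (suExp N)
      (fun e => wilsonBoundaryAction (fundamentalRep (Fin N)) {e}) β
      (wordTruncation (ι := ZdEdge (d + 1)) (fundamentalLatticeRep N) n) (φ k))
    (a : Fin (d + 1) → ℤ) :
    ∀ x ∈ wordTruncation (ι := ZdEdge (d + 1)) (fundamentalLatticeRep N) (n + n),
      seqLim (fun k => avgFunctional (boxMaps (G := Matrix.specialUnitaryGroup (Fin N) ℂ) (k + 1)) (φ k))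
          (x.comp (relabelCM (G := Matrix.specialUnitaryGroup (Fin N) ℂ) (edgeShift a))) =
        seqLim (fun k => avgFunctional (boxMaps (G := Matrix.specialUnitaryGroup (Fin N) ℂ) (k + 1)) (φ k)) x := by
  set χ := fun k => avgFunctional (boxMaps (G := Matrix.specialUnitaryGroup (Fin N) ℂ) (k + 1)) (φ k) with hχdef
  have hχ : ∀ k, IsBootstrapFeasible (fundamentalLatticeRep N) (suExp N)
      (fun e => wilsonBoundaryAction (fundamentalRep (Fin N)) {e}) β
      (wordTruncation (ι := ZdEdge (d + 1)) (fundamentalLatticeRep N) n) (χ k) := fun k =>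
    isBootstrapFeasible_avgFunctional (fundamentalLatticeRep N) _ fun b =>
      (hφ k).translateFun (fundamentalLatticeRep N) (wilsonBoundaryAction_translationCovariant_suN N)
        (comp_relabelCM_edgeShift_mem_wordTruncation (fundamentalLatticeRep N) n) (boxPt (k + 1) b)
  have hbd : ∀ x ∈ certDomainZdSuN (d := d + 1) N β n, x ∈ seqBounded χ := fun x hx => by
    obtain ⟨C, hC⟩ := exists_forall_feasible_abs_le (fundamentalLatticeRep N) hx
    exact ⟨C, fun k => hC _ (hχ k)⟩
  refine forall_invariant_of_single (seqLim χ)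
    (V := wordTruncation (ι := ZdEdge (d + 1)) (fundamentalLatticeRep N) (n + n))
    (comp_relabelCM_edgeShift_mem_wordTruncation (fundamentalLatticeRep N) (n + n)) (fun j x hx => ?_) a
  -- unit vectors: the box averages are `2C/(k+1)`-invariant, so the Banach limit is invariant
  have hxd : x ∈ certDomainZdSuN (d := d + 1) N β n := mem_certDomain_of_mem_wordTruncation _ hx
  obtain ⟨C, hC⟩ := exists_forall_feasible_abs_le (fundamentalLatticeRep N) hxd
  refine seqLim_eq_of_tendsto_sub χ
    (hbd _ (mem_certDomain_of_mem_wordTruncation _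
      (comp_relabelCM_edgeShift_mem_wordTruncation (fundamentalLatticeRep N) (n + n) _ hx))) (hbd _ hxd) ?_
  have hbound : ∀ k, |χ k (x.comp (relabelCM (G := Matrix.specialUnitaryGroup (Fin N) ℂ) (edgeShift (Pi.single j 1)))) -
      χ k x| ≤ 2 * C / ((k : ℝ) + 1) := fun k => by
    have h := abs_avgFunctional_box_shift_sub_le (G := Matrix.specialUnitaryGroup (Fin N) ℂ) (k := k + 1)
      (Nat.succ_pos k) (φ k) (x := x) (C := C)
      (fun v => hC _ ((hφ k).translateFun (fundamentalLatticeRep N) (wilsonBoundaryAction_translationCovariant_suN N)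
        (comp_relabelCM_edgeShift_mem_wordTruncation (fundamentalLatticeRep N) n) v)) j
    simpa [hχdef] using h
  have hC0 : 0 ≤ C := (abs_nonneg _).trans (hC _ (hχ 0))
  refine squeeze_zero_norm (fun k => (Real.norm_eq_abs _).le.trans (hbound k)) ?_
  have h := (tendsto_const_div_atTop_nhds_zero_nat (2 * C)).comp (tendsto_add_atTop_nat 1)
  refine h.congr fun k => ?_
  simp only [Function.comp_apply, Nat.cast_add, Nat.cast_one]

/-- ★★★ **The translation-reduced upper bound of a Wilson loop on `ℤ^{d+1}` is the infimum over boxes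
of the plain upper bounds of its box averages.** `SU(N)`, any real `β`, any level `n`, `P` a
combination of words of length `≤ 2n`:
`sup symLevelValues_n(P) = inf_k sup levelValues_n(boxAvgObs (k+1) P)`. (`≤`: a reduced solution
gives every box average the value of `P`; `≥`: a Banach limit, in the box size, of box averages of
box-optimisers is a reduced solution whose value is the Banach limit of the optima.) [folklore] -/
theorem sSup_symLevelValuesZd_eq_iInf_boxAvg_suN {n : ℕ}
    {P : C(LGConfig (d + 1) (Matrix.specialUnitaryGroup (Fin N) ℂ), ℝ)}
    (hP : P ∈ wordTruncation (ι := ZdEdge (d + 1)) (fundamentalLatticeRep N) (n + n)) :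
    sSup (symLevelValuesZdSuN (d := d + 1) N β n P) =
      ⨅ k : ℕ, sSup (levelValuesZdSuN (d := d + 1) N β n (boxAvgObs (k + 1) P)) := by
  set t : ℕ → ℝ := fun k => sSup (levelValuesZdSuN (d := d + 1) N β n (boxAvgObs (k + 1) P)) with htdef
  have hle : ∀ k, sSup (symLevelValuesZdSuN (d := d + 1) N β n P) ≤ t k := fun k =>
    sSup_symLevelValuesZd_le_boxAvg_suN N β (Nat.succ_pos k) hP
  refine le_antisymm (le_ciInf hle) ?_
  -- box optimisers
  have hmem : ∀ k, boxAvgObs (k + 1) P ∈ certDomainZdSuN (d := d + 1) N β n := fun k =>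
    mem_certDomain_of_mem_wordTruncation _ (boxAvgObs_mem_wordTruncation (fundamentalLatticeRep N) (k + 1) hP)
  have hopt : ∀ k, ∃ φ : C(LGConfig (d + 1) (Matrix.specialUnitaryGroup (Fin N) ℂ), ℝ) →ₗ[ℝ] ℝ,
      IsBootstrapFeasible (fundamentalLatticeRep N) (suExp N)
        (fun e => wilsonBoundaryAction (fundamentalRep (Fin N)) {e}) β
        (wordTruncation (ι := ZdEdge (d + 1)) (fundamentalLatticeRep N) n) φ ∧
      φ (boxAvgObs (k + 1) P) = t k := fun k => by
    obtain ⟨lo, hi, hlohi, hEq⟩ := levelValuesZd_eq_Icc_suN N β (hmem k)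
    have ht : t k = hi := by rw [htdef]; simp only [hEq, csSup_Icc hlohi]
    have hhi : hi ∈ levelValuesZdSuN (d := d + 1) N β n (boxAvgObs (k + 1) P) := by
      rw [hEq]; exact Set.right_mem_Icc.2 hlohi
    obtain ⟨φ, hφ, hφv⟩ := hhi
    exact ⟨φ, hφ, hφv.trans ht.symm⟩
  choose φ hφ hφt using hopt
  set χ := fun k => avgFunctional (boxMaps (G := Matrix.specialUnitaryGroup (Fin N) ℂ) (k + 1)) (φ k) with hχdef
  have hχ : ∀ k, IsBootstrapFeasible (fundamentalLatticeRep N) (suExp N)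
      (fun e => wilsonBoundaryAction (fundamentalRep (Fin N)) {e}) β
      (wordTruncation (ι := ZdEdge (d + 1)) (fundamentalLatticeRep N) n) (χ k) := fun k =>
    isBootstrapFeasible_avgFunctional (fundamentalLatticeRep N) _ fun b =>
      (hφ k).translateFun (fundamentalLatticeRep N) (wilsonBoundaryAction_translationCovariant_suN N)
        (comp_relabelCM_edgeShift_mem_wordTruncation (fundamentalLatticeRep N) n) (boxPt (k + 1) b)
  -- the Banach limit of the box averages of the optimisers
  have hΛ := isBootstrapFeasible_seqLim N β χ hχ
  have hΛinv := seqLim_translationInvariant N β φ hφ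
  have hΛP : seqLim χ P ∈ symLevelValuesZdSuN (d := d + 1) N β n P :=
    ⟨seqLim χ, hΛ, fun a x hx => hΛinv a x hx, rfl⟩
  -- its value at `P` is the Banach limit of the optima
  have hPd : P ∈ certDomainZdSuN (d := d + 1) N β n := mem_certDomain_of_mem_wordTruncation _ hP
  obtain ⟨C, hC⟩ := exists_forall_feasible_abs_le (fundamentalLatticeRep N) hPd
  have hPb : P ∈ seqBounded χ := ⟨C, fun k => hC _ (hχ k)⟩
  have hval : ∀ k, χ k P = t k := fun k => by
    rw [hχdef]
    simp only
    rw [avgFunctional_box_apply (k + 1), hφt k]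
  have hbddB : BddBelow (Set.range t) := ⟨_, by rintro _ ⟨k, rfl⟩; exact hle k⟩
  have hge : (⨅ k, t k) ≤ seqLim χ P :=
    le_seqLim χ hPb fun k => (hval k) ▸ ciInf_le hbddB k
  obtain ⟨hbdd, -, -⟩ := bdd_symLevelValuesZd_suN N β hPd
  exact hge.trans (le_csSup hbdd hΛP)

end ZdSuN

end Summit.QuantumFields.GaugeBoot

end
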